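import Mathlib
import Literature.NumberTheory.LFunctions.Zhang2022.TypedSection15C
import Literature.NumberTheory.LFunctions.Zhang2022.Section15Eval1524
import Literature.NumberTheory.LFunctions.Zhang2022.Section15RhoProductsRate
import HarnessLib

/-!
# Zhang (2022) §15: the coarse node `Skeleton.Ded1524` refined — (15.24) from the typed displays
# (15.6), (15.17), (15.23) and the values u058–u059 of `ℛ₁*`, `ℛ₁ⱼ`

Topic `Literature/NumberTheory/LFunctions/Zhang2022` (Landau–Siegel audit tree; verdict-neutral).
Y. Zhang, *Discrete mean estimates and the Landau–Siegel zero*, arXiv:2211.02515v1 (2022)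
[Zhang2022LandauSiegel] — an unrefereed manuscript under adjudication (cell siegel-zhang, D-0069,
discharge lane). The banked cone leaf `Skeleton.Ded1524 c′ := Prop141 → Lemma55 → Lemma58 →
Lemma151 c′ → Eval1524 c′` ("§15 ⇒ (15.24)") is here REFINED to the typed displays of the campaign's
slices `TypedSection15A/B/C` (every display a CLAIM node of the manuscript, stated not asserted):

* `eval1524_of_displays` — **(15.24) = `Skeleton.Eval1524 c′` follows from** (15.6)
  (`Typed.Section15A.Eq15_6 c′ bLit`: `Φ₁ = Σ_{p∼P}Φ₁(p) + o(𝔓)`), (15.17) (`Typed.Section15B.Eq15_17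
  c′ bLit`: `Φ₁(p) = ℛ₁*Dpφ(D)⁻¹Σⱼℛ₁ⱼ𝒮₁ⱼ + o(p)`), (15.23) (`Typed.Section15C.Eq15_23 c′ inputs15AB`:
  `𝒮₁ⱼ = 𝔢ⱼ𝔞φ(D)/D + O(𝓛⁻³)`), and the values u058 (`ℛ₁* = β₁β₂L′(1,χ) + O(𝓛⁻²⁴)`), u059
  (`ℛ₁ⱼ = P₄^{β₃−βⱼ}/((β_{j+1}−βⱼ)(β_{j+2}−βⱼ)L′(1,χ)) + O(𝓛⁻³)`) (`Typed.Section15C.Step15_u058/059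
  c′ inputs15AB`) — through `Ded1524.eval1524_of_rates` and the kernel "direct calculation"
  `Ded1524.prod_rate5_of_values` (`ℛ₁*ℛ₁ⱼ = (1,2,1)ⱼ + O(𝓛⁻⁵)`), WITHOUT any upper bound on `𝔞`;
  `ded1524_of_displays` is the same as the banked implication `Skeleton.Ded1524 c′`;
* `eval1524_of_displays_chi` — the same under the χ-absorbed coefficient reading `bChi`
  (`inputs15ABchi`, GAP row G-L4t1-1 of the cell's ledger);
* `eval1524_of_printedRates` / `eval1524_of_printed_displays` — the route AS PRINTED, through the
  values `ℛ₁*ℛ₁ⱼ = 1, 2, 1 + O(1/𝓛)` (`Step15_u060/061/062`): it closes only with an EXTRA hypothesis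
  `𝔞 ≤ A₀` under (A) (`hAup`), not in print (§2 p.6 records "(A) implies `𝔞 ≫ 1`" only; the tree has
  `frakALowerBound_holds` and the crude `𝔞 ≪ 𝓛⁴`) — the printed `O(1/𝓛)` times the size of `𝔞` is
  the error of the main term. This is the cell's GAP candidate for Z22:§15.u060–u062 (class:
  in-cone, repairable — repaired by the first bullet).

WHAT THIS IS NOT: a proof of (15.6), (15.17), (15.23), u058 or u059 (typed CLAIM nodes whose
deductions from Prop. 14.1, Lemmas 5.5/5.8/15.1–15.3 and Appendix A are the manuscript's §15), nor
any claim about Theorems 1–2 or Landau–Siegel zeros.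

## References
* Y. Zhang, arXiv:2211.02515v1 (2022), §15 pp. 82–88, (15.6), (15.17), (15.23), (15.24); §2 (2.31),
  p.6. [cite: Zhang2022LandauSiegel, §15 (15.24) p.88]
-/

noncomputable section

open Complex Real ComplexConjugate
open Literature.NumberTheory.LFunctions.Zhang2022.Skeleton
open Literature.NumberTheory.LFunctions.Zhang2022.Typed

namespace Literature.NumberTheory.LFunctions.Zhang2022.Ded1524

/-! ## 1. The printed route: rate `O(1/𝓛)` + an upper bound on `𝔞` -/

/-- The PRINTED rate `ℛ₁*ℛ₁ⱼ = (1,2,1)ⱼ + O(1/𝓛)` (u060–u062 as typed) gives `δ(1 + 𝔞) → 0` ONLY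
together with an upper bound `𝔞 ≤ A₀` under (A) (not stated in print; the tree proves `𝔞 ≫ 1`,
`frakALowerBound_holds`, and the crude `𝔞 ≪ 𝓛⁴`, nothing in between). [cite: Zhang2022LandauSiegel, §15 p.88] -/
theorem delta_small_of_rate1 {R : ∀ (D : ℕ) [NeZero D], DirichletCharacter ℂ D → ℕ → ℂ}
    {Rs : ∀ (D : ℕ) [NeZero D], DirichletCharacter ℂ D → ℂ}
    (hprod : ∃ C : ℝ, ForAllLarge fun D _ χ => AssumptionA D χ →
      ‖Rs D χ * R D χ 1 - 1‖ ≤ C / ell D ∧ ‖Rs D χ * R D χ 2 - 2‖ ≤ C / ell D ∧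
        ‖Rs D χ * R D χ 3 - 1‖ ≤ C / ell D)
    (hAup : ∃ A₀ : ℝ, ForAllLarge fun D _ χ => AssumptionA D χ → frakA χ ≤ A₀) :
    ∀ ε : ℝ, 0 < ε → ForAllLarge fun D _ χ => AssumptionA D χ →
      (‖Rs D χ * R D χ 1 - 1‖ + ‖Rs D χ * R D χ 2 - 2‖ + ‖Rs D χ * R D χ 3 - 1‖) *
        (1 + frakA χ) ≤ ε := by
  intro ε hε
  obtain ⟨C, hC⟩ := hprod
  obtain ⟨A₀, hA₀⟩ := hAup
  set M : ℝ := max 1 (3 * |C| * (1 + |A₀|) / ε) with hM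
  have hT : ForAllLarge fun D _ _ => M ≤ ell D := by
    refine ForAllLarge.of_le ⌈Real.exp M⌉₊ fun D _ _ hD _ _ => ?_
    have h : Real.exp M ≤ D := le_trans (Nat.le_ceil _) (by exact_mod_cast hD)
    exact (Real.le_log_iff_exp_le (lt_of_lt_of_le (Real.exp_pos _) h)).mpr h
  obtain ⟨D₀, h⟩ := (hC.and hA₀).and hT
  refine ⟨D₀, fun D _ χ hD hq hp hA => ?_⟩
  obtain ⟨⟨h1, hA1⟩, h2⟩ := h D χ hD hq hp
  obtain ⟨hu1, hu2, hu3⟩ := h1 hA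
  have hA1 := hA1 hA
  have hℓ1 : 1 ≤ ell D := (le_max_left _ _).trans h2
  have hℓ0 : 0 < ell D := by linarith
  have hCε : 3 * |C| * (1 + |A₀|) / ε ≤ ell D := (le_max_right _ _).trans h2
  have hA0 : 0 ≤ frakA χ := frakA_nonneg χ
  have hδ : ‖Rs D χ * R D χ 1 - 1‖ + ‖Rs D χ * R D χ 2 - 2‖ + ‖Rs D χ * R D χ 3 - 1‖ ≤
      3 * |C| / ell D := by
    have e : ∀ x : ℝ, x ≤ C / ell D → x ≤ |C| / ell D := fun x hx =>
      hx.trans (by gcongr; exact le_abs_self C)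
    have := e _ hu1; have := e _ hu2; have := e _ hu3
    have h3 : 3 * |C| / ell D = 3 * (|C| / ell D) := by ring
    rw [h3]; linarith
  calc (‖Rs D χ * R D χ 1 - 1‖ + ‖Rs D χ * R D χ 2 - 2‖ + ‖Rs D χ * R D χ 3 - 1‖) * (1 + frakA χ)
      ≤ 3 * |C| / ell D * (1 + |A₀|) := by
        gcongr; exact hA1.trans (le_abs_self A₀)
    _ = 3 * |C| * (1 + |A₀|) / ell D := by ring
    _ ≤ ε := by rw [div_le_iff₀ hℓ0]; rw [div_le_iff₀ hε] at hCε; linarith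

/-- **(15.24) from (15.6), (15.17), (15.23) and the PRINTED values `ℛ₁*ℛ₁ⱼ = 1, 2, 1 + O(1/𝓛)`**,
abstract in the §15A/B objects — needs IN ADDITION `𝔞 ≤ A₀` under (A) (`hAup`).
[cite: Zhang2022LandauSiegel, §15 (15.24) p.88] -/
theorem eval1524_of_printedRates {c' : ℝ}
    {Φp S R : ∀ (D : ℕ) [NeZero D], DirichletCharacter ℂ D → ℕ → ℂ}
    {Rs : ∀ (D : ℕ) [NeZero D], DirichletCharacter ℂ D → ℂ}
    (h6 : ∀ ε : ℝ, 0 < ε → ForAllLarge fun D _ χ => AssumptionA D χ →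
      ‖Phi1 c' χ - ∑ p ∈ primeWindow D, Φp D χ p‖ ≤ ε * frakP D)
    (h17 : ∀ ε : ℝ, 0 < ε → ForAllLarge fun D _ χ => AssumptionA D χ → ∀ p ∈ primeWindow D,
      ‖Φp D χ p - Rs D χ * (D : ℂ) * (p : ℂ) / (Nat.totient D : ℂ) *
          ∑ j ∈ ({1, 2, 3} : Finset ℕ), R D χ j * S D χ j‖ ≤ ε * p)
    (h23 : ∃ C : ℝ, ForAllLarge fun D _ χ => AssumptionA D χ → ∀ j ∈ ({1, 2, 3} : Finset ℕ),
      ‖S D χ j - frake j * (frakA χ : ℂ) * (Nat.totient D : ℂ) / (D : ℂ)‖ ≤ C / ell D ^ 3)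
    (hprod : ∃ C : ℝ, ForAllLarge fun D _ χ => AssumptionA D χ →
      ‖Rs D χ * R D χ 1 - 1‖ ≤ C / ell D ∧ ‖Rs D χ * R D χ 2 - 2‖ ≤ C / ell D ∧
        ‖Rs D χ * R D χ 3 - 1‖ ≤ C / ell D)
    (hAup : ∃ A₀ : ℝ, ForAllLarge fun D _ χ => AssumptionA D χ → frakA χ ≤ A₀) :
    Eval1524 c' :=
  eval1524_of_coeff h6 h17
    (coeff_eventually (eta_small_of_rate h23) (delta_small_of_rate1 hprod hAup))

/-! ## 2. The instantiation with the typed displays of `TypedSection15A/B/C` -/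

section Typed

variable (c' : ℝ)

/-- **(15.24) from the typed displays (15.6), (15.17), (15.23), u058, u059** (printed coefficient
reading `bLit`, instance `Typed.Section15C.inputs15AB`), with NO upper bound on `𝔞`: the values
u058–u059 give `ℛ₁*ℛ₁ⱼ = (1,2,1)ⱼ + O(𝓛⁻⁵)` (`prod_rate5_of_values`), which `eval1524_of_rates`
consumes. [cite: Zhang2022LandauSiegel, §15 (15.24) p.88] -/
theorem eval1524_of_displays (h6 : Section15A.Eq15_6 c' Section15A.bLit)
    (h17 : Section15B.Eq15_17 c' Section15A.bLit)
    (h23 : Section15C.Eq15_23 c' Section15C.inputs15AB)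
    (h58 : Section15C.Step15_u058 c' Section15C.inputs15AB)
    (h59 : Section15C.Step15_u059 c' Section15C.inputs15AB) : Eval1524 c' :=
  eval1524_of_rates
    (Φp := fun D _ χ p => Section15A.Phi1pOf c' χ (Section15A.bLit D χ) p)
    (S := fun D _ χ j => Section15B.calS1 c' χ (Section15A.bLit D χ) j)
    (R := fun _ _ χ j => Section15B.calR1 c' χ j)
    (Rs := fun _ _ χ => Section15A.calR1star c' χ)
    h6 h17 h23 (prod_rate5_of_values c' h58 h59)

/-- **The banked coarse node `Skeleton.Ded1524 c′`, from the same typed displays** (its hypotheses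
Prop. 14.1, Lemmas 5.5, 5.8, 15.1 are the inputs of the displays' own deductions in §15, not used
again here). [cite: Zhang2022LandauSiegel, §15 (15.1)–(15.24)] -/
theorem ded1524_of_displays (h6 : Section15A.Eq15_6 c' Section15A.bLit)
    (h17 : Section15B.Eq15_17 c' Section15A.bLit)
    (h23 : Section15C.Eq15_23 c' Section15C.inputs15AB)
    (h58 : Section15C.Step15_u058 c' Section15C.inputs15AB)
    (h59 : Section15C.Step15_u059 c' Section15C.inputs15AB) : Ded1524 c' :=
  fun _ _ _ _ => eval1524_of_displays c' h6 h17 h23 h58 h59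

/-- The same under the χ-absorbed coefficient reading `bChi` (instance `inputs15ABchi`; cf. the
cell's GAP row G-L4t1-1 on the reading of `b` in (15.1)). [cite: Zhang2022LandauSiegel, §15 (15.24) p.88] -/
theorem eval1524_of_displays_chi (h6 : Section15A.Eq15_6 c' Section15A.bChi)
    (h17 : Section15B.Eq15_17 c' Section15A.bChi)
    (h23 : Section15C.Eq15_23 c' Section15C.inputs15ABchi)
    (h58 : Section15C.Step15_u058 c' Section15C.inputs15ABchi)
    (h59 : Section15C.Step15_u059 c' Section15C.inputs15ABchi) : Eval1524 c' :=
  eval1524_of_rates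
    (Φp := fun D _ χ p => Section15A.Phi1pOf c' χ (Section15A.bChi D χ) p)
    (S := fun D _ χ j => Section15B.calS1 c' χ (Section15A.bChi D χ) j)
    (R := fun _ _ χ j => Section15B.calR1 c' χ j)
    (Rs := fun _ _ χ => Section15A.calR1star c' χ)
    h6 h17 h23 (prod_rate5_of_values c' h58 h59)

/-- **The route AS PRINTED**: (15.24) from (15.6), (15.17), (15.23) and u060–u062 (`ℛ₁*ℛ₁ⱼ = 1, 2, 1
+ O(1/𝓛)`, `Typed.Section15C.Step15_u060/061/062`) — with the EXTRA hypothesis `hAup` (`𝔞 ≤ A₀`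
under (A)), which the manuscript does not supply. [cite: Zhang2022LandauSiegel, §15 (15.24) p.88] -/
theorem eval1524_of_printed_displays (h6 : Section15A.Eq15_6 c' Section15A.bLit)
    (h17 : Section15B.Eq15_17 c' Section15A.bLit)
    (h23 : Section15C.Eq15_23 c' Section15C.inputs15AB)
    (h60 : Section15C.Step15_u060 c' Section15C.inputs15AB)
    (h61 : Section15C.Step15_u061 c' Section15C.inputs15AB)
    (h62 : Section15C.Step15_u062 c' Section15C.inputs15AB)
    (hAup : ∃ A₀ : ℝ, ForAllLarge fun D _ χ => AssumptionA D χ → frakA χ ≤ A₀) : Eval1524 c' := by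
  refine eval1524_of_printedRates
    (Φp := fun D _ χ p => Section15A.Phi1pOf c' χ (Section15A.bLit D χ) p)
    (S := fun D _ χ j => Section15B.calS1 c' χ (Section15A.bLit D χ) j)
    (R := fun _ _ χ j => Section15B.calR1 c' χ j)
    (Rs := fun _ _ χ => Section15A.calR1star c' χ)
    h6 h17 h23 ?_ hAup
  obtain ⟨C₀, h0⟩ := h60
  obtain ⟨C₁, h1⟩ := h61
  obtain ⟨C₂, h2⟩ := h62
  obtain ⟨D₀, h⟩ := (h0.and h1).and h2
  refine ⟨max C₀ (max C₁ C₂), D₀, fun D _ χ hD hq hp hA => ?_⟩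
  obtain ⟨⟨g0, g1⟩, g2⟩ := h D χ hD hq hp
  have hℓ : 0 ≤ ell D := Real.log_natCast_nonneg D
  refine ⟨(g0 hA).trans ?_, (g1 hA).trans ?_, (g2 hA).trans ?_⟩
  · exact div_le_div_of_nonneg_right (le_max_left _ _) hℓ
  · exact div_le_div_of_nonneg_right ((le_max_left _ _).trans (le_max_right _ _)) hℓ
  · exact div_le_div_of_nonneg_right ((le_max_right _ _).trans (le_max_right _ _)) hℓ

end Typed

end Literature.NumberTheory.LFunctions.Zhang2022.Ded1524
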